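import Literature.NumberTheory.Automorphic.LocalComponentBJ
import Literature.NumberTheory.Automorphic.AutomorphicRepsGLSatakeFlathProofs
import Literature.NumberTheory.Automorphic.AutomorphicRepLieActionGL
import HarnessLib

/-!
# Local components at unramified places are spherical: proof of
`AutomorphicRepData.hasLocalComponentAt_spherical_of_hasSatakeParamAt`

Topic `NumberTheory/Automorphic`; sibling proof file of
`Literature.NumberTheory.Automorphic.LocalComponentBJ`, discharging its named fact

* `AutomorphicRepData.hasLocalComponentAt_spherical_of_hasSatakeParamAt n K hcpt`
  (`hasLocalComponentAt_spherical_of_hasSatakeParamAt_holds`): for an automorphic representation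
  `π = W / W'` of `GL_n(𝔸_K)` in the sense of Borel–Jacquet, a finite place `v` at which `π` has a
  Satake parameter (a `K(𝔫)`-spherical form `φ ∈ W ∖ W'`, `v ∤ 𝔫 ≠ 0`) and an irreducible smooth
  local component `π_v` (`HasLocalComponentAt`: a non-zero `GL_n(K_v)`-map `V → W / W'`), the
  representation `π_v` has a non-zero vector fixed by `GL_n(𝒪_v)`.

## The proof (no tensor product theorem)

The printed route is Flath's theorem (Flath, Corvallis 1979, Thm. 3 and Thm. 4: `W / W'` is
admissible and factorisable, `W / W' ≅ ⊗'_w π_w`, so its restriction to `GL_n(K_v)` is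
`π_v`-isotypic, and `π_v` is unramified as soon as `W / W'` has a `GL_n(𝒪_v)`-fixed vector;
Borel–Jacquet, Corvallis 1979, §4.6). It is replaced by the following averaging argument, the
companion of the algebraic Schur lemma of `AutomorphicRepsGLSatakeFlathProofs` (which it reuses:
sums over `K / N`, the centralising family `{r(c) | c_v = 1} ∪ {r(k) | k ∈ K_∞} ∪ {X ∈ 𝔤}`).

1. `exists_ne_zero_mem_fixedPoints_of_irreducible` (**abstract spherical transfer**). Let `σ` be
   a complex representation of a group `G` on `Q`, `K ≤ G`, and `𝓔` a set of linear operators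
   commuting with `σ(G)` such that `Q` has no proper non-zero `σ(G)`- and `𝓔`-stable subspace.
   If `Q` has a non-zero `K`-fixed vector `q₀`, then every non-zero `σ(G)`-stable subspace `N`
   all of whose vectors are fixed by finite-index subgroups of `K` has a non-zero `K`-fixed
   vector: `Q` is spanned by the `T y`, `T` a word in `𝓔`, `y ∈ N` (irreducibility); summing
   the `K / U`-translates for `U` small of finite index maps each `T y` to `T (∑ y)` with `∑ y`
   a `K`-fixed vector of `N` (`subgroupQuotientSum_apply_mem_fixedPoints_of_forall`), and maps
   `q₀` to `[K : U] q₀`; so `q₀ = 0` if `N^K = 0`.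
2. **Assembly** on `Q = W / W'` (`AutomorphicRepData.Quot`) with `σ` = right translation along
   `ι_v : GL_n(K_v) ↪ GL_n(𝔸_K)` (`π.finiteRep`, `GLn.ofLocal_mem_range_ofFinite`),
   `K = GL_n(𝒪_v)` (`valuedCongruenceSubgroup (Fin n) 1`), `𝓔` = `π.finiteRep c` (`c_v = 1`),
   `π.kRep k`, `π.lieRep X` (the descended Lie derivatives of `AutomorphicRepLieActionGL`), which
   commute with `σ` (`GLn.ofLocal_mul_eq_mul_ofLocal_of_toLocal_eq_one`, `kRep_comm_finiteRep`,
   `lieDeriv_comp_mul_right`) and whose stable subspaces pull back to the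
   `(𝔤, K_∞) × GL_n(𝔸_K^∞)`-stable subspaces between `W'` and `W`
   (`GL_n(𝔸_K^∞) = ι_v(GL_n(K_v)) · {c_v = 1}`), so that `π.irreducible` applies; `q₀ = [φ]`
   (`isMaximalAt_principalCongruenceLevel`: `ι_v(GL_n(𝒪_v)) ≤ K(𝔫)` for `v ∤ 𝔫`); `N` = the image
   of `V → W / W'`, whose vectors have open stabilisers (`π_v` smooth) meeting the compact open
   `GL_n(𝒪_v)` (`isCompact_valuedCongruenceSubgroup_one`) in finite-index subgroups
   (Mathlib `Subgroup.quotient_finite_of_isOpen`); the map `V → W / W'` is injective (`π_v`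
   irreducible, Mathlib `Representation.IsIrreducible.injective_or_eq_zero`), so a non-zero
   `GL_n(𝒪_v)`-fixed vector of `N` comes from one of `V` (`map_mem_valuedCongruenceSubgroup_one`).

## Design notes

* Theorems only; no definition, no new named fact, no `sorry`. The abstract theorem is stated
  for honest linear operators on the quotient `W / W'` (unlike the function-level hypotheses of
  `exists_heckeOperator_sub_smul_mem_of_irreducible`), the Lie derivatives having been descended
  to `W / W'` in `AutomorphicRepLieActionGL` (`π.lieRep`, `lieRep_mkQ`).
* (H1) No file-level `LieRing.ofAssociativeRing` instance attribute is needed (the Lie algebra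
  `𝔤` only enters through `π.lieRep`, `π.lieDerivW` and `lieDeriv`); (H5) `open scoped Classical`.

## References

* D. Flath, *Decomposition of representations into tensor products*, Proc. Sympos. Pure Math. 33
  (Corvallis 1977), Part 1 (1979), 179–183, Thm. 3, Thm. 4 [FlathCorvallis1979].
* A. Borel, H. Jacquet, *Automorphic forms and automorphic representations*, Corvallis (1979),
  Part 1, §4.6 [BorelJacquetCorvallis1979].
* D. Bump, *Automorphic forms and representations*, Cambridge (1997), Thm. 3.3.3 (tensor product
  theorem, after Flath), §3.4 [Bump1997].
* J. R. Getz, H. Hahn, *An introduction to automorphic representations*, GTM 300 (2024), §4.5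
  (Prop. 4.5.3), §7.1 [GetzHahn2024].
* C. Bushnell, G. Henniart, *The local Langlands conjecture for GL(2)* (2006), §4.2 (the
  idempotent `e_K`) [BushnellHenniart2006].
-/

open scoped MatrixGroups Matrix Classical
open NumberField NumberField.mixedEmbedding IsDedekindDomain

noncomputable section

namespace Literature.NumberTheory.Automorphic

/-! ### 1. Abstract spherical transfer -/

section Abstract

variable {G Q : Type*} [Group G] [AddCommGroup Q] [Module ℂ Q]
  (σ : Representation ℂ G Q) (K : Subgroup G)

/-- **The sum over `K / N` of the translates of an `N`-fixed vector is `K`-fixed** (`N ≤ K` of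
finite index; the sum over chosen coset representatives `∑_{q ∈ K/N} σ(q̃) y` is `[K : N]` times
the average of `y` over `K`: left multiplication by `k ∈ K` permutes `K / N` and changes the
representatives by elements of `N`). Bushnell–Henniart (2006), §4.2 (the idempotent `e_K`).
[folklore] -/
theorem subgroupQuotientSum_apply_mem_fixedPoints_of_forall (N : Subgroup K) [N.FiniteIndex]
    {y : Q} (hy : ∀ u : K, u ∈ N → σ (u : G) y = y) :
    (∑ᶠ q : K ⧸ N, σ ((q.out : K) : G)) y ∈ σ.fixedPoints K := by
  haveI : Fintype (K ⧸ N) := Fintype.ofFinite _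
  rw [Representation.mem_fixedPoints]
  intro k hk
  rw [finsum_eq_sum_of_fintype, LinearMap.sum_apply, map_sum]
  have key : ∀ q : K ⧸ N,
      σ k (σ ((q.out : K) : G) y) = σ ((((⟨k, hk⟩ : K) • q).out : K) : G) y := by
    intro q
    obtain ⟨h, hh⟩ := QuotientGroup.mk_out_eq_mul N ((⟨k, hk⟩ : K) * q.out)
    have hq : (⟨k, hk⟩ : K) • q = (((⟨k, hk⟩ : K) * q.out : K) : K ⧸ N) := by
      conv_lhs => rw [← QuotientGroup.out_eq' q]
      rfl
    rw [hq, hh, Subgroup.coe_mul, Subgroup.coe_mul, map_mul, map_mul, Module.End.mul_apply,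
      Module.End.mul_apply, hy _ h.2]
  rw [Finset.sum_congr rfl fun q _ => key q]
  exact Fintype.sum_equiv (MulAction.toPerm (⟨k, hk⟩ : K)) _ _ fun q => rfl

/-- **Abstract spherical transfer.** Let `σ` be a complex representation of a group `G` on `Q`,
`K ≤ G`, and `𝓔` a set of linear operators of `Q` commuting with `σ(G)`, such that `Q` has no
`σ(G)`- and `𝓔`-stable subspace other than `⊥` and `⊤`, and let `q₀ ≠ 0` be a `K`-fixed vector.
Then every non-zero `σ(G)`-stable subspace `N` all of whose vectors are fixed by subgroups of
finite index of `K` contains a non-zero `K`-fixed vector. (By irreducibility `Q` is spanned by the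
`T y`, `T` in the monoid generated by `𝓔`, `y ∈ N`; the sums over `K / U`, `U` small of finite
index, map `T y` to `T (∑ y)` with `∑ y ∈ N^K` and `q₀` to `[K : U] q₀`, so `N^K = 0` forces
`q₀ = 0`.) This is the algebraic content of "the restriction of `⊗'_w π_w` to `G_v` is
`π_v`-isotypic, so `π_v` is unramified if `⊗'_w π_w` has a `K_v`-fixed vector" (Flath, Corvallis
(1979), Thm. 3–4) in the form needed here; cf. Getz–Hahn (2024), Prop. 4.5.3.
[cite: FlathCorvallis1979, Thm. 3 and Thm. 4] -/
theorem exists_ne_zero_mem_fixedPoints_of_irreducible (𝓔 : Set (Module.End ℂ Q))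
    (hEcomm : ∀ E ∈ 𝓔, ∀ g : G, E * σ g = σ g * E)
    (hirr : ∀ P : Submodule ℂ Q, (∀ g : G, ∀ q ∈ P, σ g q ∈ P) →
      (∀ E ∈ 𝓔, ∀ q ∈ P, E q ∈ P) → P = ⊥ ∨ P = ⊤)
    {q₀ : Q} (hq₀ : q₀ ≠ 0) (hq₀K : q₀ ∈ σ.fixedPoints K)
    (N : Submodule ℂ Q) (hN : ∀ g : G, ∀ y ∈ N, σ g y ∈ N) (hN0 : N ≠ ⊥)
    (hNsm : ∀ y ∈ N, ∃ U : Subgroup K, U.FiniteIndex ∧ ∀ u : K, u ∈ U → σ (u : G) y = y) :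
    ∃ y ∈ N, y ≠ 0 ∧ y ∈ σ.fixedPoints K := by
  -- the monoid generated by `𝓔` centralises `σ(G)`
  set C : Submonoid (Module.End ℂ Q) := Submonoid.closure 𝓔 with hC_def
  have hCcomm : ∀ T ∈ C, ∀ g : G, T * σ g = σ g * T := by
    intro T hT g
    refine Submonoid.closure_induction (fun E hE => hEcomm E hE g) (by rw [one_mul, mul_one])
      (fun a b _ _ ha hb => ?_) hT
    rw [mul_assoc, hb, ← mul_assoc, ha, mul_assoc]
  -- `P = span {T y}` is stable, non-zero, hence everything
  set S : Set Q := {q | ∃ T ∈ C, ∃ y ∈ N, q = T y} with hS_def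
  set P : Submodule ℂ Q := Submodule.span ℂ S with hP_def
  have hNP : N ≤ P := fun y hy =>
    Submodule.subset_span ⟨1, C.one_mem, y, hy, (Module.End.one_apply y).symm⟩
  have hPσ : ∀ g : G, ∀ q ∈ P, σ g q ∈ P := by
    intro g q hq
    refine Submodule.span_induction ?_ ?_ ?_ ?_ hq
    · rintro _ ⟨T, hT, y, hy, rfl⟩
      refine Submodule.subset_span ⟨T, hT, σ g y, hN g y hy, ?_⟩
      rw [← Module.End.mul_apply, ← hCcomm T hT g, Module.End.mul_apply]
    · rw [map_zero]; exact zero_mem _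
    · intro a b _ _ ha hb
      rw [map_add]; exact add_mem ha hb
    · intro c a _ ha
      rw [map_smul]; exact Submodule.smul_mem _ _ ha
  have hPE : ∀ E ∈ 𝓔, ∀ q ∈ P, E q ∈ P := by
    intro E hE q hq
    refine Submodule.span_induction ?_ ?_ ?_ ?_ hq
    · rintro _ ⟨T, hT, y, hy, rfl⟩
      exact Submodule.subset_span
        ⟨E * T, C.mul_mem (Submonoid.subset_closure hE) hT, y, hy, rfl⟩
    · rw [map_zero]; exact zero_mem _
    · intro a b _ _ ha hb
      rw [map_add]; exact add_mem ha hb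
    · intro c a _ ha
      rw [map_smul]; exact Submodule.smul_mem _ _ ha
  have hPtop : P = ⊤ := by
    rcases hirr P hPσ hPE with h | h
    · exact absurd (le_bot_iff.1 (h ▸ hNP)) hN0
    · exact h
  -- the span of the `T y` with `y ∈ N` fixed by `K`
  set Sfix : Set Q := {q | ∃ T ∈ C, ∃ y ∈ N, y ∈ σ.fixedPoints K ∧ q = T y} with hSfix_def
  set Pfix : Submodule ℂ Q := Submodule.span ℂ Sfix with hPfix_def
  -- averaging over `K / U'` for all small enough `U'` of finite index lands in `Pfix`
  have key : ∀ q ∈ P, ∃ U : Subgroup K, U.FiniteIndex ∧ ∀ U' : Subgroup K, U'.FiniteIndex →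
      U' ≤ U → (∑ᶠ c : K ⧸ U', σ ((c.out : K) : G)) q ∈ Pfix := by
    intro q hq
    refine Submodule.span_induction ?_ ?_ ?_ ?_ hq
    · rintro _ ⟨T, hT, y, hy, rfl⟩
      obtain ⟨U, hU, hUy⟩ := hNsm y hy
      refine ⟨U, hU, fun U' hU' hle => ?_⟩
      haveI := hU'
      have hcomm' : (∑ᶠ c : K ⧸ U', σ ((c.out : K) : G)) (T y) =
          T ((∑ᶠ c : K ⧸ U', σ ((c.out : K) : G)) y) := by
        haveI : Fintype (K ⧸ U') := Fintype.ofFinite _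
        rw [finsum_eq_sum_of_fintype, LinearMap.sum_apply, LinearMap.sum_apply, map_sum]
        refine Finset.sum_congr rfl fun c _ => ?_
        rw [← Module.End.mul_apply, ← hCcomm T hT, Module.End.mul_apply]
      rw [hcomm']
      refine Submodule.subset_span ⟨T, hT, _, ?_, ?_, rfl⟩
      · exact subgroupQuotientSum_apply_mem σ K U' (fun g _ z hz => hN g z hz) hy
      · exact subgroupQuotientSum_apply_mem_fixedPoints_of_forall σ K U' fun u hu => hUy u (hle hu)
    · exact ⟨⊤, inferInstance, fun U' _ _ => by rw [map_zero]; exact zero_mem _⟩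
    · rintro a b - - ⟨U₁, hU₁, h₁⟩ ⟨U₂, hU₂, h₂⟩
      haveI := hU₁
      haveI := hU₂
      refine ⟨U₁ ⊓ U₂, inferInstance, fun U' hU' hle => ?_⟩
      rw [map_add]
      exact add_mem (h₁ U' hU' (hle.trans inf_le_left)) (h₂ U' hU' (hle.trans inf_le_right))
    · rintro c a - ⟨U₁, hU₁, h₁⟩
      refine ⟨U₁, hU₁, fun U' hU' hle => ?_⟩
      rw [map_smul]
      exact Submodule.smul_mem _ _ (h₁ U' hU' hle)
  have hq₀P : q₀ ∈ P := by rw [hPtop]; exact Submodule.mem_top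
  obtain ⟨U, hU, hkey⟩ := key q₀ hq₀P
  haveI := hU
  have h1 := hkey U hU le_rfl
  rw [subgroupQuotientSum_apply_of_mem_fixedPoints σ K U hq₀K] at h1
  have hcard : (Nat.card (K ⧸ U) : ℂ) ≠ 0 := Nat.cast_ne_zero.2 Nat.card_pos.ne'
  have h2 : q₀ ∈ Pfix := by
    have := Pfix.smul_mem ((Nat.card (K ⧸ U) : ℂ)⁻¹) h1
    rwa [inv_smul_smul₀ hcard] at this
  -- if `N` had no non-zero `K`-fixed vector, `Pfix = ⊥` and `q₀ = 0`
  by_contra hnone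
  have hPfix : Pfix ≤ ⊥ := by
    refine Submodule.span_le.2 ?_
    rintro _ ⟨T, hT, y, hy, hyK, rfl⟩
    have hy0 : y = 0 := by
      by_contra hy0
      exact hnone ⟨y, hy, hy0, hyK⟩
    rw [hy0, map_zero]
    exact zero_mem _
  exact hq₀ ((Submodule.mem_bot ℂ).1 (hPfix h2))

end Abstract

/-! ### 2. Smooth vectors, `GL_n(𝒪_v)`, and `W / W'` seen from one place -/

section Smooth

variable {k G V : Type*} [CommRing k] [Group G] [TopologicalSpace G] [IsTopologicalGroup G]
  [AddCommGroup V] [Module k V]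

/-- **A smooth vector is fixed by a subgroup of finite index of any compact subgroup** `K₀` (its
stabiliser is open, and an open subgroup of a compact group has finite index; Mathlib
`Subgroup.quotient_finite_of_isOpen`). Bushnell–Henniart (2006), §2.1–2.2. [folklore] -/
theorem exists_finiteIndex_forall_apply_eq_of_isSmoothVector (ρ : Representation k G V)
    (K₀ : Subgroup G) (hK₀ : IsCompact (K₀ : Set G)) {x : V} (hx : ρ.IsSmoothVector x) :
    ∃ U : Subgroup K₀, U.FiniteIndex ∧ ∀ u : K₀, u ∈ U → ρ (u : G) x = x := by
  let U : Subgroup K₀ := (ρ.stabilizerSubgroup x).subgroupOf K₀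
  have hUopen : IsOpen (U : Set K₀) := Subgroup.subgroupOf_isOpen K₀ _ hx
  haveI : CompactSpace K₀ := isCompact_iff_compactSpace.mp hK₀
  haveI : Finite (K₀ ⧸ U) := Subgroup.quotient_finite_of_isOpen U hUopen
  exact ⟨U, Subgroup.finiteIndex_of_finite_quotient, fun u hu => Subgroup.mem_subgroupOf.1 hu⟩

end Smooth

section Local

variable (n : ℕ) (K : Type) [Field K] [NumberField K] (v : HeightOneSpectrum (𝓞 K))

/-- An invertible matrix over `𝒪_v` defines an element of
`GL_n(𝒪_v) = valuedCongruenceSubgroup (Fin n) 1 ≤ GL_n(K_v)` (its entries and those of its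
inverse are integral, and `|g - 1|_v ≤ 1` follows). Bump (1997), §3.3. [folklore] -/
theorem GLn.map_subtype_mem_valuedCongruenceSubgroup_one
    (u : GL (Fin n) (v.adicCompletionIntegers K)) :
    Matrix.GeneralLinearGroup.map (v.adicCompletionIntegers K).subtype u ∈
      (valuedCongruenceSubgroup (Fin n) (1 : WithZero (Multiplicative ℤ)) :
        Subgroup (GL (Fin n) (v.adicCompletion K))) := by
  have hint : ∀ (w : GL (Fin n) (v.adicCompletionIntegers K)) (i j : Fin n),
      Valued.v ((Matrix.GeneralLinearGroup.map (v.adicCompletionIntegers K).subtype w :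
        Matrix (Fin n) (Fin n) (v.adicCompletion K)) i j) ≤ 1 := fun w i j =>
    ((w : Matrix (Fin n) (Fin n) (v.adicCompletionIntegers K)) i j).2
  refine ⟨hint u, fun i j => ?_, fun i j => ?_⟩
  · rw [← map_inv]
    exact hint u⁻¹ i j
  · rw [Matrix.sub_apply]
    refine (Valuation.map_sub _ _ _).trans (max_le (hint u i j) ?_)
    rw [Matrix.one_apply]
    split_ifs <;> simp

end Local

namespace AutomorphicRepData

variable {n : ℕ} {K : Type} [Field K] [NumberField K] {hcpt : isCompact_glFiniteIntegralLevel n K}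
  (π : AutomorphicRepData (AutomorphyDatum.gl n K hcpt))

/-- **The Lie algebra action and the `GL_n(𝔸_K^∞)`-action on `W / W'` commute** (`G_∞` and
`G(𝔸_f)` commute in `G(𝔸_K)`: `lieDeriv_comp_mul_right`, `commute_ofArch`).
Borel–Jacquet, Corvallis (1979), §4.6. [folklore] -/
theorem lieRep_comm_finiteRep (X : (AutomorphyDatum.gl n K hcpt).arch.lie)
    (h : (AutomorphyDatum.gl n K hcpt).finiteAdelic) (q : π.Quot) :
    π.lieRep X (π.finiteRep h q) = π.finiteRep h (π.lieRep X q) := by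
  have hlie_mk : ∀ ψ : π.W,
      π.lieRep X (Submodule.Quotient.mk ψ) = Submodule.Quotient.mk (π.lieDerivW X ψ) :=
    fun ψ => π.lieRep_mkQ X ψ
  induction q using Submodule.Quotient.induction_on with
  | H ψ =>
    rw [π.finiteRep_mk, hlie_mk, hlie_mk, π.finiteRep_mk]
    congr 1
    exact Subtype.ext (lieDeriv_comp_mul_right (AutomorphyDatum.gl n K hcpt).ofArch X
      (ψ : (AdelicGroupData.gl n K).Adelic → ℂ)
      fun a => (AutomorphyDatum.gl n K hcpt).commute_ofArch a _ h.2)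

/-- **Irreducibility of `W / W'` seen from one finite place `v`.** A subspace of `W / W'` stable
under right translation by `ι_v(GL_n(K_v))`, by the finite-adelic elements trivial at `v`, by
`K_∞`, and under `𝔤` is `⊥` or `⊤`: its preimage in `W` contains `W'` and is
`(𝔤, K_∞) × GL_n(𝔸_K^∞)`-stable, because `GL_n(𝔸_K^∞) = ι_v(GL_n(K_v)) · {c | c_v = 1}`
(`GLn.toLocal_ofLocal`), so `π.irreducible` applies. Borel–Jacquet, Corvallis (1979), §4.6
(irreducible `(𝔤, K_∞) × G(𝔸_f)`-subquotients of the space of automorphic forms).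
[cite: BorelJacquetCorvallis1979, §4.6] -/
theorem quot_eq_bot_or_eq_top_of_stable (v : HeightOneSpectrum (𝓞 K)) (P : Submodule ℂ π.Quot)
    (hPv : ∀ t : GL (Fin n) (v.adicCompletion K), ∀ q ∈ P,
      π.finiteRep ⟨GLn.ofLocal n K v t, GLn.ofLocal_mem_range_ofFinite v t⟩ q ∈ P)
    (hPc : ∀ c : (AutomorphyDatum.gl n K hcpt).finiteAdelic,
      (AdelicGroupData.gl n K).toLocal v c = 1 → ∀ q ∈ P, π.finiteRep c q ∈ P)
    (hPk : ∀ k : (AutomorphyDatum.gl n K hcpt).arch.maximalCompact, ∀ q ∈ P, π.kRep k q ∈ P)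
    (hPX : ∀ X : (AutomorphyDatum.gl n K hcpt).arch.lie, ∀ q ∈ P, π.lieRep X q ∈ P) :
    P = ⊥ ∨ P = ⊤ := by
  -- the local embedding, typed on `𝒢.Adelic` (Probe5 typing rule of `AutomorphicRepsGL`)
  let ι : GL (Fin n) (v.adicCompletion K) →* (AdelicGroupData.gl n K).Adelic := GLn.ofLocal n K v
  -- the preimage of `P` in `W`, as a space of functions
  set M : Submodule ℂ ((AdelicGroupData.gl n K).Adelic → ℂ) :=
    (P.comap π.mkQ).map π.W.subtype with hM_def
  have hmemM : ∀ ψ, ψ ∈ M ↔ ∃ hψ : ψ ∈ π.W, π.mkQ ⟨ψ, hψ⟩ ∈ P := by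
    intro ψ
    constructor
    · rintro ⟨ψ', hψ', rfl⟩
      exact ⟨ψ'.2, hψ'⟩
    · rintro ⟨hψ, h⟩
      exact ⟨⟨ψ, hψ⟩, h, rfl⟩
  have h₁ : π.W' ≤ M := by
    intro ψ hψ
    refine (hmemM ψ).2 ⟨π.lt.le hψ, ?_⟩
    have h0 : π.mkQ ⟨ψ, π.lt.le hψ⟩ = 0 := by
      rw [Submodule.mkQ_apply, Submodule.Quotient.mk_eq_zero]
      exact hψ
    rw [h0]
    exact zero_mem _
  have h₂ : M ≤ π.W := by
    rintro _ ⟨ψ', -, rfl⟩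
    exact ψ'.2
  have hMf : ∀ h : (AutomorphyDatum.gl n K hcpt).finiteAdelic, (∀ q ∈ P, π.finiteRep h q ∈ P) →
      ∀ ψ ∈ M, rightTranslation (AdelicGroupData.gl n K)
        (h : (AdelicGroupData.gl n K).Adelic) ψ ∈ M := by
    intro h hP' ψ hψ
    obtain ⟨hψW, hP⟩ := (hmemM ψ).1 hψ
    refine (hmemM _).2 ⟨π.stable.finite_stable _ h.2 hψW, ?_⟩
    have := hP' _ hP
    rw [Submodule.mkQ_apply, π.finiteRep_mk] at this
    exact this
  have hMk : ∀ k : (AutomorphyDatum.gl n K hcpt).arch.maximalCompact, ∀ ψ ∈ M,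
      rightTranslation (AdelicGroupData.gl n K) ((AutomorphyDatum.gl n K hcpt).ofK k) ψ ∈ M := by
    intro k ψ hψ
    obtain ⟨hψW, hP⟩ := (hmemM ψ).1 hψ
    refine (hmemM _).2 ⟨π.stable.k_stable k hψW, ?_⟩
    have := hPk k _ hP
    rw [Submodule.mkQ_apply, π.kRep_mk] at this
    exact this
  have hMX : ∀ X : (AutomorphyDatum.gl n K hcpt).arch.lie, ∀ ψ ∈ M,
      lieDeriv (AutomorphyDatum.gl n K hcpt).ofArch X ψ ∈ M := by
    intro X ψ hψ
    obtain ⟨hψW, hP⟩ := (hmemM ψ).1 hψ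
    refine (hmemM _).2 ⟨π.stable.lie_stable X ψ hψW, ?_⟩
    have := hPX X _ hP
    rw [π.lieRep_mkQ] at this
    exact this
  have hstab : IsStableSubmodule (AutomorphyDatum.gl n K hcpt) M := by
    refine ⟨h₂.trans π.stable.le_automorphicForms, ?_, ?_, ?_⟩
    · -- `h = ι_v(h_v) · c` with `c_v = 1`
      intro h hh ψ hψ
      rw [Submodule.mem_comap]
      set l : GL (Fin n) (v.adicCompletion K) := (AdelicGroupData.gl n K).toLocal v h with hl
      have hlmem : ι l ∈ (AutomorphyDatum.gl n K hcpt).finiteAdelic :=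
        GLn.ofLocal_mem_range_ofFinite v l
      set c : (AdelicGroupData.gl n K).Adelic := (ι l)⁻¹ * h with hc_def
      have hc : (AdelicGroupData.gl n K).toLocal v c = 1 := by
        rw [hc_def, map_mul, map_inv]
        have : (AdelicGroupData.gl n K).toLocal v (ι l) = l := GLn.toLocal_ofLocal l
        rw [this, ← hl, inv_mul_cancel]
      have hcf : c ∈ (AutomorphyDatum.gl n K hcpt).finiteAdelic := mul_mem (inv_mem hlmem) hh
      have hh' : h = ι l * c := by rw [hc_def, mul_inv_cancel_left]
      rw [hh', map_mul, Module.End.mul_apply]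
      exact hMf ⟨_, hlmem⟩ (hPv l) _ (hMf ⟨c, hcf⟩ (hPc ⟨c, hcf⟩ hc) ψ hψ)
    · exact fun k ψ hψ => hMk k ψ hψ
    · exact fun X ψ hψ => hMX X ψ hψ
  rcases π.irreducible M h₁ h₂ hstab with hMW' | hMW
  · left
    refine (Submodule.eq_bot_iff _).2 fun q hq => ?_
    obtain ⟨ψ, rfl⟩ := π.kerQuot.mkQ_surjective q
    have hψM : (ψ : (AdelicGroupData.gl n K).Adelic → ℂ) ∈ M := (hmemM ψ).2 ⟨ψ.2, hq⟩
    rw [hMW'] at hψM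
    exact (Submodule.Quotient.mk_eq_zero π.kerQuot).2 hψM
  · right
    refine eq_top_iff.2 fun q _ => ?_
    obtain ⟨ψ, rfl⟩ := π.kerQuot.mkQ_surjective q
    have hψM : (ψ : (AdelicGroupData.gl n K).Adelic → ℂ) ∈ M := by rw [hMW]; exact ψ.2
    obtain ⟨_, h⟩ := (hmemM ψ).1 hψM
    exact h

/-! ### 3. Assembly: local components at places with a Satake parameter are spherical -/

/-- **The named fact `AutomorphicRepData.hasLocalComponentAt_spherical_of_hasSatakeParamAt` holds**:
if the automorphic representation `π = W / W'` of `GL_n(𝔸_K)` (Borel–Jacquet model) has a Satake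
parameter at the finite place `v` and the irreducible smooth representation `π_v` of `GL_n(K_v)`
is a local component of `π` at `v`, then `π_v` has a non-zero `GL_n(𝒪_v)`-fixed vector. The
`K(𝔫)`-spherical form `φ ∈ W ∖ W'` (`v ∤ 𝔫`) gives a non-zero `GL_n(𝒪_v)`-fixed vector of
`W / W'` (`isMaximalAt_principalCongruenceLevel`); the image of `V → W / W'` is a non-zero
`GL_n(K_v)`-stable subspace of smooth vectors (stabilisers open in `GL_n(K_v)` meet the compact
open `GL_n(𝒪_v)` with finite index), so it has a non-zero `GL_n(𝒪_v)`-fixed vector by the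
abstract spherical transfer `exists_ne_zero_mem_fixedPoints_of_irreducible` applied to the
`(𝔤, K_∞) × GL_n(𝔸_K^∞)`-irreducible `W / W'` (`quot_eq_bot_or_eq_top_of_stable`); it comes
from `V`, the map `V → W / W'` being injective (`π_v` irreducible). Printed sources of the
fact: Flath, Corvallis (1979), Thm. 3 and Thm. 4 (the tensor product theorem: an irreducible
admissible representation of `G(𝔸)` is factorisable, `π ≅ ⊗'_v π_v` with `π_v` irreducible
admissible, unramified for almost all `v`, the local factors being determined by `π`), as stated
for `GL(n, 𝔸)` in Bump (1997), Thm. 3.3.3 (proof in §3.4 "based on Flath (1979)");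
Borel–Jacquet, Corvallis (1979), §4.6. The proof given here replaces the tensor product theorem
by the averaging argument of `exists_ne_zero_mem_fixedPoints_of_irreducible`.
[cite: FlathCorvallis1979, Thm. 3 and Thm. 4] [cite: Bump1997, Thm. 3.3.3]
[cite: BorelJacquetCorvallis1979, §4.6] -/
theorem hasLocalComponentAt_spherical_of_hasSatakeParamAt_holds :
    hasLocalComponentAt_spherical_of_hasSatakeParamAt n K hcpt := by
  intro π v α πv hα hloc
  obtain ⟨𝔫, ϖ, h𝔫, hv, -, -, φ, hφW, hφW', hfix, -⟩ := hα
  obtain ⟨f, hfW, hfW', hf⟩ := hloc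
  -- the local embedding `ι = ι_v : GL_n(K_v) →* GL_n(𝔸_K)` lands in `GL_n(𝔸_K^∞)`
  let ι : GL (Fin n) (v.adicCompletion K) →* (AdelicGroupData.gl n K).Adelic := GLn.ofLocal n K v
  have hιmem : ∀ t, ι t ∈ (AutomorphyDatum.gl n K hcpt).finiteAdelic := fun t =>
    GLn.ofLocal_mem_range_ofFinite v t
  let ι' : GL (Fin n) (v.adicCompletion K) →* (AutomorphyDatum.gl n K hcpt).finiteAdelic :=
    ι.codRestrict _ hιmem
  let K₀ : Subgroup (GL (Fin n) (v.adicCompletion K)) :=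
    valuedCongruenceSubgroup (Fin n) (1 : WithZero (Multiplicative ℤ))
  -- `GL_n(K_v)` acting on `W / W'` by right translation along `ι`
  let σ : Representation ℂ (GL (Fin n) (v.adicCompletion K)) π.Quot := π.finiteRep.comp ι'
  have hσ_mk : ∀ (t : GL (Fin n) (v.adicCompletion K)) (ψ : π.W),
      σ t (Submodule.Quotient.mk ψ) = Submodule.Quotient.mk (p := π.kerQuot)
        ⟨rightTranslation (AdelicGroupData.gl n K) (ι t) ψ,
          π.stable.finite_stable _ (hιmem t) ψ.2⟩ := fun _ _ => rfl
  -- the extra operators on `W / W'`: `r(c)` (`c_v = 1`), `r(k)` (`k ∈ K_∞`), `X ∈ 𝔤`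
  let 𝓔 : Set (Module.End ℂ π.Quot) :=
    ({E | ∃ c : (AutomorphyDatum.gl n K hcpt).finiteAdelic,
        (AdelicGroupData.gl n K).toLocal v c = 1 ∧ E = π.finiteRep c} ∪
      {E | ∃ k : (AutomorphyDatum.gl n K hcpt).arch.maximalCompact, E = π.kRep k}) ∪
      {E | ∃ X : (AutomorphyDatum.gl n K hcpt).arch.lie, E = π.lieRep X}
  have hEcomm : ∀ E ∈ 𝓔, ∀ t, E * σ t = σ t * E := by
    rintro E ((⟨c, hc, rfl⟩ | ⟨k, rfl⟩) | ⟨X, rfl⟩) t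
    · change π.finiteRep c * π.finiteRep (ι' t) = π.finiteRep (ι' t) * π.finiteRep c
      rw [← map_mul, ← map_mul]
      congr 1
      exact Subtype.ext (GLn.ofLocal_mul_eq_mul_ofLocal_of_toLocal_eq_one t hc).symm
    · exact LinearMap.ext fun q => π.kRep_comm_finiteRep k (ι' t) q
    · exact LinearMap.ext fun q => π.lieRep_comm_finiteRep X (ι' t) q
  have hirrQ : ∀ P : Submodule ℂ π.Quot, (∀ t, ∀ q ∈ P, σ t q ∈ P) →
      (∀ E ∈ 𝓔, ∀ q ∈ P, E q ∈ P) → P = ⊥ ∨ P = ⊤ := fun P hPσ hPE =>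
    π.quot_eq_bot_or_eq_top_of_stable v P (fun t q hq => hPσ t q hq)
      (fun c hc q hq => hPE _ (Or.inl (Or.inl ⟨c, hc, rfl⟩)) q hq)
      (fun k q hq => hPE _ (Or.inl (Or.inr ⟨k, rfl⟩)) q hq)
      (fun X q hq => hPE _ (Or.inr ⟨X, rfl⟩) q hq)
  -- the spherical vector `q₀ = [φ]`
  have hφK₀ : ∀ k ∈ K₀, rightTranslation (AdelicGroupData.gl n K) (ι k) φ = φ := fun k hk =>
    hfix _ (isMaximalAt_principalCongruenceLevel n K v h𝔫 hv ⟨k, hk, rfl⟩)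
  set q₀ : π.Quot := π.mkQ ⟨φ, hφW⟩ with hq₀_def
  have hq₀ : q₀ ≠ 0 := by
    intro h
    rw [hq₀_def, Submodule.mkQ_apply, Submodule.Quotient.mk_eq_zero] at h
    exact hφW' h
  have hq₀K : q₀ ∈ σ.fixedPoints K₀ := by
    rw [Representation.mem_fixedPoints]
    intro k hk
    rw [hq₀_def, Submodule.mkQ_apply, hσ_mk]
    congr 1
    exact Subtype.ext (hφK₀ k hk)
  -- the local component map `V → W / W'`: equivariant, non-zero, injective
  let fW : πv.V →ₗ[ℂ] π.W :=
    LinearMap.codRestrict π.W f fun x => hfW (LinearMap.mem_range_self f x)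
  let fQ : πv.V →ₗ[ℂ] π.Quot := π.mkQ ∘ₗ fW
  have hfQ_apply : ∀ x, fQ x = Submodule.Quotient.mk (p := π.kerQuot)
      ⟨f x, hfW (LinearMap.mem_range_self f x)⟩ := fun x => rfl
  have hfQ_equiv : ∀ (g : GL (Fin n) (v.adicCompletion K)) (x : πv.V),
      fQ (πv.ρ g x) = σ g (fQ x) := by
    intro g x
    rw [hfQ_apply, hfQ_apply, hσ_mk, Submodule.Quotient.eq]
    exact hf g x
  have hfQ_ne : fQ ≠ 0 := by
    intro h0
    refine hfW' ?_
    rintro _ ⟨x, rfl⟩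
    have hx : fQ x = 0 := by rw [h0, LinearMap.zero_apply]
    rw [hfQ_apply, Submodule.Quotient.mk_eq_zero] at hx
    exact hx
  have hfQ_inj : Function.Injective fQ := by
    rcases Representation.IsIrreducible.injective_or_eq_zero
        (fQ.intertwiningMap_of_isIntertwiningMap πv.ρ σ hfQ_equiv) with h | h
    · exact h
    · refine absurd (LinearMap.ext fun x => ?_) hfQ_ne
      exact DFunLike.congr_fun h x
  -- its image `N`, whose vectors are fixed by finite-index subgroups of `GL_n(𝒪_v)`
  set N : Submodule ℂ π.Quot := LinearMap.range fQ with hN_def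
  have hN : ∀ g, ∀ y ∈ N, σ g y ∈ N := by
    rintro g _ ⟨x, rfl⟩
    exact ⟨πv.ρ g x, hfQ_equiv g x⟩
  have hN0 : N ≠ ⊥ := fun h => hfQ_ne (LinearMap.range_eq_bot.1 h)
  have hNsm : ∀ y ∈ N, ∃ U : Subgroup K₀, U.FiniteIndex ∧
      ∀ u : K₀, u ∈ U → σ (u : GL (Fin n) (v.adicCompletion K)) y = y := by
    rintro _ ⟨x, rfl⟩
    obtain ⟨U, hU, hUx⟩ := exists_finiteIndex_forall_apply_eq_of_isSmoothVector πv.ρ K₀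
      (isCompact_valuedCongruenceSubgroup_one n K v) (πv.isSmooth x)
    exact ⟨U, hU, fun u hu => by rw [← hfQ_equiv, hUx u hu]⟩
  -- the abstract spherical transfer, pulled back to `V`
  obtain ⟨y, hyN, hy0, hyK⟩ := exists_ne_zero_mem_fixedPoints_of_irreducible σ K₀ 𝓔 hEcomm
    hirrQ hq₀ hq₀K N hN hN0 hNsm
  obtain ⟨x, rfl⟩ := LinearMap.mem_range.1 hyN
  refine ⟨x, fun hx => hy0 (by rw [hx, map_zero]), fun g hg => ?_⟩
  obtain ⟨u, rfl⟩ := MonoidHom.mem_range.1 hg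
  apply hfQ_inj
  rw [hfQ_equiv]
  exact (σ.mem_fixedPoints K₀ _).1 hyK _ (GLn.map_subtype_mem_valuedCongruenceSubgroup_one n K v u)

end AutomorphicRepData

end Literature.NumberTheory.Automorphic

end
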